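import Literature.MathematicalPhysics.QuantumFieldTheory.Balaban1983to89.B8SockHFPTorusTraceFree
import Literature.MathematicalPhysics.QuantumFieldTheory.Balaban1983to89.B8Thm2TorusServerP
import Literature.MathematicalPhysics.QuantumFieldTheory.Balaban1983to89.B8LeafModelZdSockP5uE
import Literature.MathematicalPhysics.QuantumFieldTheory.Balaban1983to89.B8Eq131Derivation

/-!
# `Balaban1983to89.B8Thm2TorusServerP2` — [Balaban1985RegularSpaces] Prop. 5 on `T_η`: route P's Proposition-5 STEP SOCKET `SockP5Step … G` for ONE
# periodic `G`-valued background, from the letters (`LettersAt` + `LettersTau`), the group data of the joint J-SU and print's «exactly one» displayed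
# (sub-row «G-B8-T2S», route P, layer L4 §2b)

statement-level skeleton of published theorems with citation tags; proofs where landed; nothing here is a claim about the
Yang–Mills mass gap

T. Bałaban, *Spaces of regular gauge field configurations …*, Commun. Math. Phys. **99** (1985) 75–102 `[Balaban1985RegularSpaces]` ("B8"): Prop. 5
(1.106)–(1.109) p. 94 («there exists exactly one function λ»), Thm 4 p. 88, p. 77 («Ω_j = T_η»), p. 76 (`G = SU(N)`).  STATUS: published, refereed.

CITATION HEADER (lean-in-tree rule).  Cell `lit-balaban`, seat `lit-balaban-t2s-1` (gen 0), sub-row «G-B8-T2S» (R3 `stmt-QuantumFields-19200`), route P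
layer L4 §2b (`lit-balaban-t2s-1/J-SU-ROADMAP.md`).  WHAT IS REPRODUCED.  `B8SockHFPTorusTraceFree.sockHFPτ_family_of_lettersAt` (the `τ`-free ∃λ-bodies at
the torus member from the letters) composed with `B8Thm2TorusServerP.sockP5Step_body_of_traceFree` (the adapter: `G`-valued by the group law, periodic by
«exactly one»), for every level `1 ≤ m < k`:
* ★ `sockP5Step_of_lettersAt` — `B8Thm2TorusSupplier.SockP5Step L P η c⋆ α₄ G U₀ U′ m` at `c⋆ = 5dLB₀(α₀ + α₁)`, `α₄ = 8B₀′·5dLB₀·(α₀ + α₁)` for a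
  `P`-periodic (`P ∈ Lᵏℤ`) `G`-valued background pair in Theorem 2's regime on `T_η`, GIVEN: the letters `ℓ : LettersAt … k α₀ U₀` with `τ`-laws, the b9
  socket at every level, the JOIN's windows at `(α₀, α₁)`, the group data (`G ≤ H`, (H2), (H3), `G` averaging-closed unitary, «`e^{iλ} ∈ G` for Hermitian
  `τ`-free `λ`»), and print's «exactly one» at every level in the adapter's shape (`hUq`, displayed; to be served from the knit's `SockP5uE` at the
  torus members — route K's socket).
NOT CLAIMED: the base socket (§2b′, analogous over `sockHFP₀τ_family_of_lettersAt` ∕ `sockP5Base_body_of_traceFree`), `Sock142`∕`Sock159`∕`SockP5Uniq`,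
the discharge of `hUq`.

HONEST SCOPE.  Composition; no new analysis.  Count-neutral; N05 ∕ `stub_PV3A` NOT discharged; nothing continuum ∕ ℝ⁴ ∕ OS ∕ mass-gap ∕ Clay.
No `sorry`, no `def`, no `… : Prop` fact, no `instance`, no `notation`.
-/

noncomputable section

open NormedSpace
open scoped BigOperators

namespace Literature.MathematicalPhysics.QuantumFieldTheory.Balaban1983to89.B8Thm2TorusServerP2

open Complex (I)
open MatrixLog (mlog)
open B7Prop1Explicit B7Prop2Explicit B7Prop1Local B7Eq92Concrete
open B7Prop2Explicit (C0 c2')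
open B7Prop3Flat (c3)
open B7Prop10General (C6 C4G)
open B7Prop10Flat (one_le_C5)
open B7Prop9Flat (C5')
open B7Eq78Linearization (conjR)
open B8Ineq132 (covDerivFwd InAk)
open B8Eq119TwistedAxial (Restr129 InAx)
open B8Eq184Proof (gaugeExp cfgExp)
open B8Lemma1NonAbelian (mulCfg)
open B8Eq140Level (SideTouches)
open B8Eq138LandauZd (IsLandau138W)
open B8Ineq125Concrete (C2p)
open B8LeafModelZd3 (SockB9P3)
open B8Prop5ContractionKLevel (Mc Kc)
open B8Thm4TorusAt (torusLam)
open B8Thm2TorusMember (torusLamb)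
open B8Thm2TorusLetters (LettersAt LettersTau)
open B8Thm2TorusSupplier (SockP5Step SockP5Base SockP5Uniq sideTouches_univ)
open B8SockHFPTorusTraceFree (sockHFPτ_family_of_lettersAt sockHFP₀τ_family_of_lettersAt)
open B8Thm2TorusServerP (sockP5Step_body_of_traceFree sockP5Base_body_of_traceFree)

-- `Site` alone could resolve to the torus sites of `Setup.lean`; re-export the `ℤ^d` sites of `B7Prop1Explicit`.
export B7Prop1Explicit (Site)

variable {d : ℕ} {𝔸 : Type*} [CStarAlgebra 𝔸] [Nontrivial 𝔸]
variable (τ : 𝔸 →L[ℂ] ℂ)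

/-- ★ **ROUTE P's PROPOSITION-5 STEP SOCKET AT EVERY LEVEL `1 ≤ m < k`, FROM THE LETTERS, THE J-SU GROUP DATA AND «EXACTLY ONE»** (p. 94 on `T_η`).
[cite: Balaban1985RegularSpaces, Prop. 5 (1.106)–(1.109) p.94 («there exists exactly one function λ»), Thm 4 p.88, p.77, p.76] -/
theorem sockP5Step_of_lettersAt (hτ : ∀ x y : 𝔸, τ (x * y) = τ (y * x)) (hd2 : 2 ≤ d) {L : ℕ} (hL : 2 ≤ L) {η : ℝ} (hη : 0 < η) {k : ℕ}
    {P : ℤ} (hP : ∃ M : ℤ, P = (L : ℤ) ^ k * M)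
    {G H : Subgroup 𝔸ˣ} (hGrp2 : ∀ g ∈ H, ‖(g : 𝔸) - 1‖ ≤ 1 / 8 → τ (mlog (g : 𝔸)) = 0) (hGrp3 : ∀ S : 𝔸, τ S = 0 → expUnit S ∈ H)
    (hGA : AvgClosed d L G) (hGH : G ≤ H) (hGu : G ≤ unitaryUnits 𝔸)
    (hG3 : ∀ (lam : Site d → 𝔸) (x : Site d), IsSelfAdjoint (lam x) → τ (lam x) = 0 → gaugeExp lam x ∈ G)
    {α₀ α₁ B₀ B₀' B₀'H B₂' BG BR B₀β cB9 cB β cu : ℝ} {len : Site d → ℝ} (hα₀ : 0 < α₀) (hα₁ : 0 < α₁)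
    (hB₀ : 0 < B₀) (hB₀' : 0 < B₀') (hB₀'H : 0 < B₀'H) (hB₂' : 0 ≤ B₂') (hBG : 0 ≤ BG) (hBR : 0 ≤ BR)
    (hcu : 8 * B₀' * (5 * (d : ℝ) * L * B₀) * (α₀ + α₁) < cu)
    {U₀ U' : Site d → Fin d → 𝔸ˣ} (hU₀G : ∀ x κ, U₀ x κ ∈ G) (hU'G : ∀ x κ, U' x κ ∈ G)
    (hU₀P : ∀ (x : Site d) (i : Fin d), U₀ (x + P • e i) = U₀ x) (hU'P : ∀ (x : Site d) (i : Fin d), U' (x + P • e i) = U' x)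
    (h33 : InAk L k η α₀ (fun _ => (Set.univ : Set (Site d))) U₀) (h34 : InAk L k η α₀ (fun _ => (Set.univ : Set (Site d))) (mulCfg U' U₀))
    (hAx : ∀ m', m' ≤ k → InAx L m' (torusLam (d := d) m') U₀ (mulCfg U' U₀))
    (h135 : ∀ j, j ≤ k → ∀ (z : Site d) (μ : Fin d), (∀ x, InBox (loK L j z) (bondHiK L j z μ) x → x ∈ (fun _ => (Set.univ : Set (Site d))) j) →
      ‖(avgIter L (mulCfg U' U₀) j z μ : 𝔸) - (avgIter L U₀ j z μ : 𝔸)‖ ≤ α₁)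
    (ℓ : LettersAt (𝔸 := 𝔸) L BG BR B₀'H B₂' B₀ B₀β cB β len η k α₀ U₀) (ℓτ : LettersTau (𝔸 := 𝔸) τ ℓ)
    (SB9all : ∀ m, m ≤ k → SockB9P3 (𝔸 := 𝔸) L B₀ B₀β cB9 β len η m (fun _ => (Set.univ : Set (Site d)))
      (fun m => torusLam (d := d) m) (fun m => torusLamb (d := d) m))
    (hwin : ∀ cs α₄ cB cDA hE hE₂ lE lE₂ : ℝ, cs = 5 * (d : ℝ) * L * B₀ * (α₀ + α₁) → α₄ = 8 * B₀' * (5 * (d : ℝ) * L * B₀) * (α₀ + α₁) →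
      cB = L * cs → cDA = 2 * (d : ℝ) * (L : ℝ) ^ 2 * cs →
      hE = B₀'H * (C2p d * (40 * d * cB + α₄) * α₄) → hE₂ = B₂' * (C2p d * (40 * d * cB + α₄) * α₄) →
      lE = B₀'H * (4 * C2p d * (40 * d * cB + 2 * α₄)) → lE₂ = B₂' * (4 * C2p d * (40 * d * cB + 2 * α₄)) →
      36 * d * B₀ * cs ≤ 1 / 2 ∧
      8 * (131072 * ((d : ℝ) + 1) ^ 2) * Real.exp (4 * (800 * ((d : ℝ) + 1) ^ 2 * ((d : ℝ) + 4)) * α₀) ≤ 16 * (131072 * ((d : ℝ) + 1) ^ 2) ∧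
      2 * cs ^ 2 + 20 * d * α₀ * cs + 2 * (16 * (131072 * ((d : ℝ) + 1) ^ 2)) * cs ^ 2 ≤ α₀ + α₁ ∧
      (d : ℝ) * L * α₁ ≤ 1 / 8 ∧
      α₀ ≤ cB9 ∧ cs ≤ cB9 ∧
      C0 d * α₀ ≤ 1 / 3 ∧ 4 * α₀ ≤ c2' d L ∧
      Real.exp (4 * (800 * ((d : ℝ) + 1) ^ 2 * ((d : ℝ) + 4)) * α₀) * (1 + 8 * (131072 * ((d : ℝ) + 1) ^ 2) * cB) ≤ 2 ∧
      2 * cB ≤ c3 d L ∧ 2048 * (d : ℝ) * cB ≤ 1 ∧ 40 * d * cB ≤ 1 / 200 ∧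
      200 * C6 d * (2 * α₄) ≤ 1 ∧ 12000 * ((d : ℝ) + 1) * L * (2 * α₄) ≤ 1 ∧
      C4G d L * (α₀ + 40 * d * cB + 4 * (2 * α₄)) ≤ 1 ∧
      1024 * ((d : ℝ) + 1) * ((d : ℝ) + 4) * L ^ 2 * α₀ ≤ 1 ∧ 32 * ((d : ℝ) + 1) ^ 2 * C6 d * L ^ 2 * α₀ ≤ 1 ∧
      16 * d * C5' d * C6 d * (L : ℝ) ^ 2 * α₀ ≤ 1 ∧ 8 * d * C6 d * L * α₀ ≤ 1 ∧
      40 * d * cB + α₄ ≤ 1 / (4 * B₀'H * (2 * C2p d)) ∧ 2 * C6 d * (40 * d * cB + 4 * α₄) ≤ 1 / 8 ∧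
      cB ≤ 1 / 13 ∧ α₄ / 4 + hE ≤ 1 / 24 ∧ α₄ / 4 + hE ≤ 1 / 140 ∧ 10 * (α₄ / 4 + hE) * BR ≤ 1 / 2 ∧
      BG * Mc d BR (α₄ / 4 + hE) cB hE₂ cDA ≤ α₄ / 4 ∧
      BG * Kc d BR (α₄ / 4 + hE) cB hE₂ cDA lE₂ (1 + lE) (1 + lE) ≤ 1 / 2)
    -- print's «exactly one» at every level, in the adapter's shape (displayed; the knit's `SockP5uE` at the torus members)
    (hUq : ∀ m, 1 ≤ m → m < k → ∀ (u₁ : Site d → 𝔸ˣ) (U₁ : Site d → Fin d → 𝔸ˣ), ∀ (v w : Site d → 𝔸ˣ) (lam mu : Site d → 𝔸),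
      (∀ x, ((gaugeExp lam x : 𝔸ˣ) : 𝔸) = ((v x : 𝔸ˣ) : 𝔸) ∧ IsSelfAdjoint (lam x) ∧ ‖lam x‖ < cu) →
      (∀ (x : Site d) (κ : Fin d), ((L : ℝ) ^ (m + 1) * η) * ‖covDerivFwd η U₀ κ lam x‖ < cu) →
      (∀ x, ((gaugeExp mu x : 𝔸ˣ) : 𝔸) = ((w x : 𝔸ˣ) : 𝔸) ∧ IsSelfAdjoint (mu x) ∧ ‖mu x‖ < cu) →
      (∀ (x : Site d) (κ : Fin d), ((L : ℝ) ^ (m + 1) * η) * ‖covDerivFwd η U₀ κ mu x‖ < cu) →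
      IsLandau138W L (m + 1) η (Set.univ : Set (Site d)) (torusLam (m + 1)) U₀ (mgauge U₀ v⁻¹ U₁) →
      Restr129 L (m + 1) (torusLam (m + 1)) U₀ (u₁ * v) →
      IsLandau138W L (m + 1) η (Set.univ : Set (Site d)) (torusLam (m + 1)) U₀ (mgauge U₀ w⁻¹ U₁) →
      Restr129 L (m + 1) (torusLam (m + 1)) U₀ (u₁ * w) → ∀ x, v x = w x) :
    ∀ m, 1 ≤ m → m < k →
      SockP5Step (𝔸 := 𝔸) L P η (5 * (d : ℝ) * L * B₀ * (α₀ + α₁)) (8 * B₀' * (5 * (d : ℝ) * L * B₀) * (α₀ + α₁)) G U₀ U' m := by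
  intro m hm1 hmk u₁ U₁ A hu₁G hu₁P hW h129 hLan hdat
  have hL1 : 1 ≤ L := le_trans (by norm_num) hL
  have hLr : (1 : ℝ) ≤ L := by exact_mod_cast hL1
  have hU₀ : ∀ x κ, U₀ x κ ∈ unitaryUnits 𝔸 := fun x κ => hGu (hU₀G x κ)
  -- two of the windows: `α₄ ≤ 1/84` and `c⋆ ≤ 1/12`
  obtain ⟨-, -, -, -, -, -, -, -, -, -, -, hα₃', hs₁, -⟩ := hwin _ _ _ _ _ _ _ _ rfl rfl rfl rfl rfl rfl rfl rfl
  have hsum : 0 ≤ α₀ + α₁ := by linarith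
  have hcs0 : 0 ≤ 5 * (d : ℝ) * L * B₀ * (α₀ + α₁) := by positivity
  have hC6 : (2 : ℝ) ≤ C6 d := by unfold C6; linarith [one_le_C5 (d := d)]
  have hα84 : 8 * B₀' * (5 * (d : ℝ) * L * B₀) * (α₀ + α₁) ≤ 1 / 84 := by
    have h0 : 0 ≤ 8 * B₀' * (5 * (d : ℝ) * L * B₀) * (α₀ + α₁) := by positivity
    nlinarith [hs₁, hC6, h0]
  have hcs12 : 5 * (d : ℝ) * L * B₀ * (α₀ + α₁) ≤ 1 / 12 := by
    have hd0 : (1 : ℝ) ≤ d := by exact_mod_cast (show 1 ≤ d by omega)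
    have hcsB : 5 * (d : ℝ) * L * B₀ * (α₀ + α₁) ≤ L * (5 * (d : ℝ) * L * B₀ * (α₀ + α₁)) := le_mul_of_one_le_left hcs0 hLr
    have hcBsmall : (d : ℝ) * (L * (5 * (d : ℝ) * L * B₀ * (α₀ + α₁))) ≤ 1 / 8000 := by linarith only [hα₃']
    have h1 : 5 * (d : ℝ) * L * B₀ * (α₀ + α₁) ≤ 1 / 8000 :=
      ((le_mul_of_one_le_left hcs0 hd0).trans (mul_le_mul_of_nonneg_left hcsB (by positivity))).trans hcBsmall
    linarith only [h1]
  -- the datum's (1.69) on the bonds touching `T_η` at every `j ≤ m` from the level-`m` bound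
  have hdat' : ∀ j, j ≤ m → ∀ b ∈ {b : Site d × Fin d | SideTouches ((fun _ => (Set.univ : Set (Site d))) j) b.1 b.2},
      U₁ b.1 b.2 = cfgExp η A b.1 b.2 ∧ IsSelfAdjoint (A b.1 b.2) ∧ ‖A b.1 b.2‖ ≤ (5 * (d : ℝ) * L * B₀ * (α₀ + α₁)) * ((L : ℝ) ^ j * η)⁻¹ := by
    intro j hj b _
    obtain ⟨h1, h2, h3⟩ := hdat b.1 b.2
    refine ⟨h1, h2, h3.trans (mul_le_mul_of_nonneg_left ?_ hcs0)⟩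
    rw [mul_inv, mul_inv]
    refine mul_le_mul_of_nonneg_right ?_ (by positivity)
    exact inv_anti₀ (by positivity) (pow_le_pow_right₀ hLr hj)
  -- the `τ`-free ∃λ-body at this datum
  have hbody := sockHFPτ_family_of_lettersAt τ hτ hd2 hL hη hGrp2 hGrp3 hGA hGH hGu hα₀ hα₁ hB₀ hB₀' hB₀'H hB₂' hBG hBR hU₀G hU'G h33 h34
    hAx h135 ℓ ℓτ SB9all hwin m hm1 hmk u₁ U₁ A hu₁G hW h129 hLan hdat'
  -- `P ∈ L^{m+1}ℤ` and the periodicity of `U₁ = u₁⁻¹U′u₁(· + e)`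
  have hP' : ∃ c : ℤ, P = (L : ℤ) ^ (m + 1) * c := by
    obtain ⟨M, hM⟩ := hP
    refine ⟨(L : ℤ) ^ (k - (m + 1)) * M, ?_⟩
    rw [hM, ← mul_assoc, ← pow_add, Nat.add_sub_cancel' (by omega : m + 1 ≤ k)]
  have hU₁P : ∀ (x : Site d) (i : Fin d), U₁ (x + P • e i) = U₁ x := by
    intro x i
    have key : ∀ y κ, U₁ y κ = (u₁ y)⁻¹ * U' y κ * Rc (U₀ y κ) (u₁ (y + e κ)) := fun y κ => by
      have h := congrFun (congrFun hW y) κ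
      rw [mgauge_apply] at h
      rw [← h]; group
    funext κ
    rw [key, key, hu₁P, hU'P, hU₀P, add_right_comm, hu₁P]
  exact sockP5Step_body_of_traceFree hd2 hη hL1 m hP' τ hG3 hU₀ hU₀P hU₁P hu₁P hα84 hcs12 hcu hdat hbody (hUq m hm1 hmk u₁ U₁)


/-- ★ **ROUTE P's PROPOSITION-5 BASE SOCKET (`u₁ = 1`, `U₁ = U′`, p. 89), FROM THE LETTERS, THE J-SU GROUP DATA AND «EXACTLY ONE»** (p. 94 on `T_η`):
`B8Thm2TorusSupplier.SockP5Base L P η α₄ G U₀ U′` at `α₄ = 8B₀′·5dLB₀·(α₀ + α₁)`, given the (1.36) exponent `A` of `U′` and print's «exactly one» at level `1`.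
[cite: Balaban1985RegularSpaces, Prop. 5 (1.106)–(1.109) p.94, p.89 (the start of the induction), (1.36) p.82, p.77, p.76] -/
theorem sockP5Base_of_lettersAt (hτ : ∀ x y : 𝔸, τ (x * y) = τ (y * x)) (hd2 : 2 ≤ d) {L : ℕ} (hL : 2 ≤ L) {η : ℝ} (hη : 0 < η) {k : ℕ}
    (hk : 1 ≤ k)
    {P : ℤ} (hP : ∃ M : ℤ, P = (L : ℤ) ^ k * M)
    {G H : Subgroup 𝔸ˣ} (hGrp2 : ∀ g ∈ H, ‖(g : 𝔸) - 1‖ ≤ 1 / 8 → τ (mlog (g : 𝔸)) = 0) (hGrp3 : ∀ S : 𝔸, τ S = 0 → expUnit S ∈ H)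
    (hGA : AvgClosed d L G) (hGH : G ≤ H) (hGu : G ≤ unitaryUnits 𝔸)
    (hG3 : ∀ (lam : Site d → 𝔸) (x : Site d), IsSelfAdjoint (lam x) → τ (lam x) = 0 → gaugeExp lam x ∈ G)
    {α₀ α₁ B₀ B₀' B₀'H B₂' BG BR B₀β cB9 cB β cu : ℝ} {len : Site d → ℝ} (hα₀ : 0 < α₀) (hα₁ : 0 < α₁)
    (hB₀ : 0 < B₀) (hB₀' : 0 < B₀') (hB₀'H : 0 < B₀'H) (hB₂' : 0 ≤ B₂') (hBG : 0 ≤ BG) (hBR : 0 ≤ BR)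
    (hcu : 8 * B₀' * (5 * (d : ℝ) * L * B₀) * (α₀ + α₁) < cu)
    {U₀ U' : Site d → Fin d → 𝔸ˣ} (hU₀G : ∀ x κ, U₀ x κ ∈ G) (hU'G : ∀ x κ, U' x κ ∈ G)
    (hU₀P : ∀ (x : Site d) (i : Fin d), U₀ (x + P • e i) = U₀ x) (hU'P : ∀ (x : Site d) (i : Fin d), U' (x + P • e i) = U' x)
    (h33 : InAk L k η α₀ (fun _ => (Set.univ : Set (Site d))) U₀) (h34 : InAk L k η α₀ (fun _ => (Set.univ : Set (Site d))) (mulCfg U' U₀))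
    (hAx : ∀ m', m' ≤ k → InAx L m' (torusLam (d := d) m') U₀ (mulCfg U' U₀))
    (ℓ : LettersAt (𝔸 := 𝔸) L BG BR B₀'H B₂' B₀ B₀β cB β len η k α₀ U₀) (ℓτ : LettersTau (𝔸 := 𝔸) τ ℓ)
    (hwin : ∀ cs α₄ cB cDA hE hE₂ lE lE₂ : ℝ, cs = 5 * (d : ℝ) * L * B₀ * (α₀ + α₁) → α₄ = 8 * B₀' * (5 * (d : ℝ) * L * B₀) * (α₀ + α₁) →
      cB = L * cs → cDA = 2 * (d : ℝ) * (L : ℝ) ^ 2 * cs →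
      hE = B₀'H * (C2p d * (40 * d * cB + α₄) * α₄) → hE₂ = B₂' * (C2p d * (40 * d * cB + α₄) * α₄) →
      lE = B₀'H * (4 * C2p d * (40 * d * cB + 2 * α₄)) → lE₂ = B₂' * (4 * C2p d * (40 * d * cB + 2 * α₄)) →
      36 * d * B₀ * cs ≤ 1 / 2 ∧
      8 * (131072 * ((d : ℝ) + 1) ^ 2) * Real.exp (4 * (800 * ((d : ℝ) + 1) ^ 2 * ((d : ℝ) + 4)) * α₀) ≤ 16 * (131072 * ((d : ℝ) + 1) ^ 2) ∧
      2 * cs ^ 2 + 20 * d * α₀ * cs + 2 * (16 * (131072 * ((d : ℝ) + 1) ^ 2)) * cs ^ 2 ≤ α₀ + α₁ ∧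
      (d : ℝ) * L * α₁ ≤ 1 / 8 ∧
      α₀ ≤ cB9 ∧ cs ≤ cB9 ∧
      C0 d * α₀ ≤ 1 / 3 ∧ 4 * α₀ ≤ c2' d L ∧
      Real.exp (4 * (800 * ((d : ℝ) + 1) ^ 2 * ((d : ℝ) + 4)) * α₀) * (1 + 8 * (131072 * ((d : ℝ) + 1) ^ 2) * cB) ≤ 2 ∧
      2 * cB ≤ c3 d L ∧ 2048 * (d : ℝ) * cB ≤ 1 ∧ 40 * d * cB ≤ 1 / 200 ∧
      200 * C6 d * (2 * α₄) ≤ 1 ∧ 12000 * ((d : ℝ) + 1) * L * (2 * α₄) ≤ 1 ∧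
      C4G d L * (α₀ + 40 * d * cB + 4 * (2 * α₄)) ≤ 1 ∧
      1024 * ((d : ℝ) + 1) * ((d : ℝ) + 4) * L ^ 2 * α₀ ≤ 1 ∧ 32 * ((d : ℝ) + 1) ^ 2 * C6 d * L ^ 2 * α₀ ≤ 1 ∧
      16 * d * C5' d * C6 d * (L : ℝ) ^ 2 * α₀ ≤ 1 ∧ 8 * d * C6 d * L * α₀ ≤ 1 ∧
      40 * d * cB + α₄ ≤ 1 / (4 * B₀'H * (2 * C2p d)) ∧ 2 * C6 d * (40 * d * cB + 4 * α₄) ≤ 1 / 8 ∧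
      cB ≤ 1 / 13 ∧ α₄ / 4 + hE ≤ 1 / 24 ∧ α₄ / 4 + hE ≤ 1 / 140 ∧ 10 * (α₄ / 4 + hE) * BR ≤ 1 / 2 ∧
      BG * Mc d BR (α₄ / 4 + hE) cB hE₂ cDA ≤ α₄ / 4 ∧
      BG * Kc d BR (α₄ / 4 + hE) cB hE₂ cDA lE₂ (1 + lE) (1 + lE) ≤ 1 / 2)
    -- the base datum `U′ = e^{iηA}` ((1.36)) and print's «exactly one» at level `1` (displayed)
    {A : Site d → Fin d → 𝔸}
    (hdat : ∀ (x : Site d) (κ : Fin d), U' x κ = cfgExp η A x κ ∧ IsSelfAdjoint (A x κ) ∧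
      ‖A x κ‖ ≤ (5 * (d : ℝ) * L * B₀ * (α₀ + α₁)) * ((L : ℝ) ^ 0 * η)⁻¹)
    (hUq : ∀ (v w : Site d → 𝔸ˣ) (lam mu : Site d → 𝔸),
      (∀ x, ((gaugeExp lam x : 𝔸ˣ) : 𝔸) = ((v x : 𝔸ˣ) : 𝔸) ∧ IsSelfAdjoint (lam x) ∧ ‖lam x‖ < cu) →
      (∀ (x : Site d) (κ : Fin d), ((L : ℝ) ^ 1 * η) * ‖covDerivFwd η U₀ κ lam x‖ < cu) →
      (∀ x, ((gaugeExp mu x : 𝔸ˣ) : 𝔸) = ((w x : 𝔸ˣ) : 𝔸) ∧ IsSelfAdjoint (mu x) ∧ ‖mu x‖ < cu) →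
      (∀ (x : Site d) (κ : Fin d), ((L : ℝ) ^ 1 * η) * ‖covDerivFwd η U₀ κ mu x‖ < cu) →
      IsLandau138W L 1 η (Set.univ : Set (Site d)) (torusLam 1) U₀ (mgauge U₀ v⁻¹ U') →
      Restr129 L 1 (torusLam 1) U₀ ((1 : Site d → 𝔸ˣ) * v) →
      IsLandau138W L 1 η (Set.univ : Set (Site d)) (torusLam 1) U₀ (mgauge U₀ w⁻¹ U') →
      Restr129 L 1 (torusLam 1) U₀ ((1 : Site d → 𝔸ˣ) * w) → ∀ x, v x = w x) :
    SockP5Base (𝔸 := 𝔸) L P η (8 * B₀' * (5 * (d : ℝ) * L * B₀) * (α₀ + α₁)) G U₀ U' := by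
  have hL1 : 1 ≤ L := le_trans (by norm_num) hL
  have hLr : (1 : ℝ) ≤ L := by exact_mod_cast hL1
  have hU₀ : ∀ x κ, U₀ x κ ∈ unitaryUnits 𝔸 := fun x κ => hGu (hU₀G x κ)
  -- two of the windows: `α₄ ≤ 1/84` and `c⋆ ≤ 1/12`
  obtain ⟨-, -, -, -, -, -, -, -, -, -, -, hα₃', hs₁, -⟩ := hwin _ _ _ _ _ _ _ _ rfl rfl rfl rfl rfl rfl rfl rfl
  have hsum : 0 ≤ α₀ + α₁ := by linarith
  have hcs0 : 0 ≤ 5 * (d : ℝ) * L * B₀ * (α₀ + α₁) := by positivity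
  have hC6 : (2 : ℝ) ≤ C6 d := by unfold C6; linarith [one_le_C5 (d := d)]
  have hα84 : 8 * B₀' * (5 * (d : ℝ) * L * B₀) * (α₀ + α₁) ≤ 1 / 84 := by
    have h0 : 0 ≤ 8 * B₀' * (5 * (d : ℝ) * L * B₀) * (α₀ + α₁) := by positivity
    nlinarith [hs₁, hC6, h0]
  have hcs12 : 5 * (d : ℝ) * L * B₀ * (α₀ + α₁) ≤ 1 / 12 := by
    have hd0 : (1 : ℝ) ≤ d := by exact_mod_cast (show 1 ≤ d by omega)
    have hcsB : 5 * (d : ℝ) * L * B₀ * (α₀ + α₁) ≤ L * (5 * (d : ℝ) * L * B₀ * (α₀ + α₁)) := le_mul_of_one_le_left hcs0 hLr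
    have hcBsmall : (d : ℝ) * (L * (5 * (d : ℝ) * L * B₀ * (α₀ + α₁))) ≤ 1 / 8000 := by linarith only [hα₃']
    have h1 : 5 * (d : ℝ) * L * B₀ * (α₀ + α₁) ≤ 1 / 8000 :=
      ((le_mul_of_one_le_left hcs0 hd0).trans (mul_le_mul_of_nonneg_left hcsB (by positivity))).trans hcBsmall
    linarith only [h1]
  -- the datum's (1.36) on the bonds touching `T_η` at `j ≤ 0`
  have hdat' : ∀ j, j ≤ 0 → ∀ b ∈ {b : Site d × Fin d | SideTouches ((fun _ => (Set.univ : Set (Site d))) j) b.1 b.2},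
      U' b.1 b.2 = cfgExp η A b.1 b.2 ∧ IsSelfAdjoint (A b.1 b.2) ∧ ‖A b.1 b.2‖ ≤ (5 * (d : ℝ) * L * B₀ * (α₀ + α₁)) * ((L : ℝ) ^ j * η)⁻¹ := by
    intro j hj b _
    have hj0 : j = 0 := Nat.le_zero.1 hj
    subst hj0
    exact hdat b.1 b.2
  -- the `τ`-free ∃λ-body at the base datum
  have hbody := sockHFP₀τ_family_of_lettersAt τ hτ hd2 hL hη hk hGrp2 hGrp3 hGA hGH hGu hα₀ hα₁ hB₀ hB₀' hB₀'H hB₂' hBG hBR hU₀G hU'G h33 h34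
    hAx ℓ ℓτ hwin A hdat'
  have hP' : ∃ c : ℤ, P = (L : ℤ) * c := by
    obtain ⟨M, hM⟩ := hP
    refine ⟨(L : ℤ) ^ (k - 1) * M, ?_⟩
    rw [hM, ← mul_assoc, ← pow_succ', Nat.sub_add_cancel hk]
  exact sockP5Base_body_of_traceFree hd2 hη hL1 hP' τ hG3 hU₀ hU₀P hU'P hα84 hcs12 hcu hdat hbody hUq


omit [Nontrivial 𝔸] in
/-- ★ **ROUTE P's THEOREM-2-LEVEL UNIQUENESS SOCKET `SockP5Uniq` FROM THE KNIT's `SockP5uE` AT THE TORUS MEMBER** (p. 94 «such a configuration u′ is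
unique», used on p. 95): for a `G`-valued pair (`G ≤ U(𝔸)`) in Theorem 2's regime on `T_η` with the (1.66)₀ closeness `‖U′ − 1‖ ≤ α₁` on every bond,
route K's uniqueness socket at the member of top level `k` (`Ω_j = T_η`, `Λ_j = torusLam`) yields `B8Thm2TorusSupplier.SockP5Uniq L k P η c_A c_u G U₀ U′`
at `c_A = 5dLB₀(α₀ + α₁)` (`16c_A ≤ 1`): the datum's `U₁ = U′^{u₁⁻¹} = e^{iηA₁}` (`mgauge_inv_mgauge`), its Landau letter is that of `A₁`
(`logCfg_cfgExp_eq`), the level-`k` gradient bound serves every `j ≤ k`.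
[cite: Balaban1985RegularSpaces, Prop. 5 (1.109) p.94, p.95 (after (1.112)), (1.36) p.82, p.77] -/
theorem sockP5Uniq_of_sockP5uE (hd2 : 2 ≤ d) {L : ℕ} (hL : 2 ≤ L) {η : ℝ} (hη : 0 < η) {k : ℕ} {P : ℤ}
    {G : Subgroup 𝔸ˣ} (hGu : G ≤ unitaryUnits 𝔸) {B₀ cP cu α₀ α₁ : ℝ} (hα₀ : 0 < α₀) (hα₁ : 0 < α₁) (hsum : α₀ + α₁ ≤ cP) (hB₀ : 0 < B₀)
    (hcA16 : 16 * (5 * (d : ℝ) * L * B₀ * (α₀ + α₁)) ≤ 1)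
    (SP5u : B8LeafModelZdSockP5uE.SockP5uE (𝔸 := 𝔸) L B₀ cP cu η k (fun _ => (Set.univ : Set (Site d))) (fun m => torusLam (d := d) m))
    {U₀ U' : Site d → Fin d → 𝔸ˣ} (hU₀G : ∀ x κ, U₀ x κ ∈ G) (hU'G : ∀ x κ, U' x κ ∈ G)
    (h33 : InAk L k η α₀ (fun _ => (Set.univ : Set (Site d))) U₀) (h34 : InAk L k η α₀ (fun _ => (Set.univ : Set (Site d))) (mulCfg U' U₀))
    (hAx : ∀ m', m' ≤ k → InAx L m' (torusLam (d := d) m') U₀ (mulCfg U' U₀))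
    (h135 : ∀ j, j ≤ k → ∀ (z : Site d) (μ : Fin d), (∀ x, InBox (loK L j z) (bondHiK L j z μ) x → x ∈ (fun _ => (Set.univ : Set (Site d))) j) →
      ‖(avgIter L (mulCfg U' U₀) j z μ : 𝔸) - (avgIter L U₀ j z μ : 𝔸)‖ ≤ α₁)
    (h166 : ∀ b ∈ {b : Site d × Fin d | SideTouches ((fun _ => (Set.univ : Set (Site d))) 0) b.1 b.2}, ‖((U' b.1 b.2 : 𝔸ˣ) : 𝔸) - 1‖ ≤ α₁) :
    SockP5Uniq (𝔸 := 𝔸) L k P η (5 * (d : ℝ) * L * B₀ * (α₀ + α₁)) cu G U₀ U' := by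
  intro u₁ A₁ hu₁G _ h129 hW hsa hbd hLan v w lam mu _ _ _ _ hv hw hLv h129v hLw h129w
  have hL1 : 1 ≤ L := le_trans (by norm_num) hL
  have hLr : (1 : ℝ) ≤ L := by exact_mod_cast hL1
  have hU₀ : ∀ x κ, U₀ x κ ∈ unitaryUnits 𝔸 := fun x κ => hGu (hU₀G x κ)
  have hU' : ∀ x κ, U' x κ ∈ unitaryUnits 𝔸 := fun x κ => hGu (hU'G x κ)
  have hu₁ : ∀ x, u₁ x ∈ unitaryUnits 𝔸 := fun x => hGu (hu₁G x)
  have hcA0 : 0 ≤ 5 * (d : ℝ) * L * B₀ * (α₀ + α₁) := by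
    have : 0 ≤ α₀ + α₁ := by linarith
    positivity
  -- `U₁ = U′^{u₁⁻¹} = e^{iηA₁}` and its Landau letter
  have hU₁ : mgauge U₀ u₁⁻¹ U' = cfgExp η A₁ := by rw [← hW]; exact B8Eq131Derivation.mgauge_inv_mgauge U₀ u₁ _
  have hlog : B8Eq138LandauZd.logCfg η (cfgExp η A₁) = A₁ := B8Thm2TorusSupplier.logCfg_cfgExp_eq hη hL1 k hcA0 hcA16 hbd
  have hLanW : IsLandau138W L k η ((fun _ => (Set.univ : Set (Site d))) 0) ((fun m => torusLam (d := d) m) k) U₀ (mgauge U₀ u₁⁻¹ U') := by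
    rw [hU₁]
    show B8Eq138LandauZd.IsLandau138 L k η (Set.univ : Set (Site d)) (torusLam k) U₀ (B8Eq138LandauZd.logCfg η (cfgExp η A₁))
    rw [hlog]; exact hLan
  -- (1.36) on the sides at every `j ≤ k` from the level-`k` bound
  have hA₁ : ∃ A : Site d → Fin d → 𝔸, ∀ j, j ≤ k → ∀ (x : Site d) (κ : Fin d), SideTouches ((fun _ => (Set.univ : Set (Site d))) j) x κ →
      mgauge U₀ u₁⁻¹ U' x κ = cfgExp η A x κ ∧ ‖A x κ‖ ≤ (5 * (d : ℝ) * L * B₀ * (α₀ + α₁)) * ((L : ℝ) ^ j * η)⁻¹ := by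
    refine ⟨A₁, fun j hj x κ _ => ⟨by rw [hU₁], (hbd x κ).trans (mul_le_mul_of_nonneg_left ?_ hcA0)⟩⟩
    rw [mul_inv, mul_inv]
    exact mul_le_mul_of_nonneg_right (inv_anti₀ (by positivity) (pow_le_pow_right₀ hLr hj)) (by positivity)
  -- the competitors' clauses in the knit's shape
  have hgrad : ∀ {l : Site d → 𝔸}, (∀ (x : Site d) (κ : Fin d), ((L : ℝ) ^ k * η) * ‖covDerivFwd η U₀ κ l x‖ < cu) →
      ∀ j, j ≤ k → ∀ b ∈ {b : Site d × Fin d | SideTouches ((fun _ => (Set.univ : Set (Site d))) j) b.1 b.2},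
        ((L : ℝ) ^ j * η) * ‖covDerivFwd η U₀ b.2 l b.1‖ < cu := by
    intro l hl j hj b _
    refine lt_of_le_of_lt ?_ (hl b.1 b.2)
    exact mul_le_mul_of_nonneg_right (mul_le_mul_of_nonneg_right (pow_le_pow_right₀ hLr hj) hη.le) (norm_nonneg _)
  have heq := SP5u α₀ α₁ hα₀ hα₁ hsum U₀ U' hU₀ hU' h33 h34 hAx h135 h166 u₁ hu₁ (fun x hx => absurd (Set.mem_univ x) hx) h129 hLanW hA₁
    v w lam mu (fun x => ⟨(hv x).1, (hv x).2.1, (hv x).2.2.1⟩) (fun x hx => absurd (Set.mem_univ x) hx) (hgrad fun x κ => (hv x).2.2.2 κ)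
    (fun x => ⟨(hw x).1, (hw x).2.1, (hw x).2.2.1⟩) (fun x hx => absurd (Set.mem_univ x) hx) (hgrad fun x κ => (hw x).2.2.2 κ)
    (by rw [hU₁]; exact hLv) h129v (by rw [hU₁]; exact hLw) h129w
  exact funext heq

#print axioms sockP5Step_of_lettersAt
#print axioms sockP5Base_of_lettersAt
#print axioms sockP5Uniq_of_sockP5uE

end Literature.MathematicalPhysics.QuantumFieldTheory.Balaban1983to89.B8Thm2TorusServerP2

end
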